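import Summits.QuantumFields.YangMills.Theorems.BalabanUVNodesN15TwoGridFirstOrderLetters
import HarnessLib

/-!
# N15 (NE2) — PROGRAMME D «THE DRESSED SOURCE-DIVERGENCE ENTRY OF THE PAIR OF RECORD», part D-A: THE FIRST-ORDER STEP IN TRANSLATION FORM AND THE FIXED POINT OF THE DRESSED
# SOURCE DIVERGENCE `X∘∇*_κ` (exact algebra; the derivative of the species never meets the dressed object)

WHO ∕ WHEN.  Cell `pub-ymgap`, seat `pub-ymgap-dag-n15-a` (KNIT-BY-NAME seat of Track-A DAG node N15 = NE2, g26); `--kind proof --supports stmt-QuantumFields-27366 --as helper` (K3⁸;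
count-neutral).  THEOREMS ONLY (0 `def`).  Over II-B `…TwoGridFirstOrderLetters` (`bgPair_value_fix'`), II-A `…TwoGridFirstOrderByParts` (`mulOp_comp_sD_eq`: the same Leibniz rule in the form
`∇∘M_{ã} − M_b`), N-IIn `…NeumannCubeRightEntries` (`symbOp_divAdj_apply`, `symbOp_sD_eq_neg_divAdj_comp_sT`), parts 34 (`symbOp`, `sT`, `sD`, `sTinv`), n15-b B1b (`bgPair`, `projO`) BY NAME; nothing in the
tree is modified.  The two-grid letters of the forward unit shift that the sequels consume with this algebra are n15-c's W-file `…FullPropagatorEntry2Rows` (`hasMaj_fshift_comp`,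
`hasMaj_idefFShift_comp`, `hasMaj_oneStepFwd_gDivAdj`) — not restated here.

WHY (HANDOFF §g25.6 (t3), located; dag-n15-d g22 ARCHITECTURE NOTE «ENTRY 2 LIVE BY PARTS»).  K-K made entries 0 (value) and 1 (dressed gradient) of [B9] (3.42) background-LIVE for the pair of
record `(Δ′_a⁻¹, Δ_a⁻¹)` under the (3.35) pair alone; entry 2 — the dressed SOURCE DIVERGENCE `Y := X∘∇*_κ`, `X = (1 − GV₁)⁻¹G`, `V₁ = M_c + Σ_μ M_{a_μ}∇_μ` — stayed located: in the LEFT form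
`Y = G∇*_κ + G V₁ Y` the derivative of `V₁` lands on `Y`, i.e. on the MIXED object `∇X∇*` (log-divergent in sup-block currency; (1.112)–(1.113) carry it only with a Hölder source norm).  THIS FILE
is the exact algebra of the way out: the lattice Leibniz rule in TRANSLATION FORM `M_a∘∇_μ = −∇*_μ∘M_a∘τ_μ − M_{b}`, `τ_μ = ρ(s_μ)` the forward unit shift, `b = n(a − a(·−e_μ))` the coefficient's own
backward quotient (the THIRD (3.35) letter), so that `G∘V₁ = G∘M_{c − Σ_μ b_μ} − Σ_μ (G∇*_μ)∘M_{a_μ}∘τ_μ` — every `U ≡ 1` factor is (1.110)'s «G» or «G∇*» (part 71's object, whose two-grid defect IS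
typed), NO forward source derivative, NO reflection (on genuine 1-forms the block-face reflection does not commute with King's prolongation: `reflSet_pull_kingPrV` carries a face-mask term).  The
one new transport is the forward unit shift acting AFTER the dressed object: its two-grid defect through King's prolongation is majorised by ONE COARSE STEP of the shifted object (n15-c
`hasMaj_idefFShift_comp`) — in the sequels it is paid by a Hölder step of the coarse DRESSED source divergence, never by a derivative.

WHAT ([folklore] lattice algebra + block-majorant bookkeeping; 0 def).
* §1 (one torus `Tor (fine n M)`, 1-forms) `sT_comp_mulOp_translate` (`τ_μ∘M_{a(·−e_μ)} = M_a∘τ_μ`), ★ `mulOp_comp_sD_eq_translate` (`M_a∘ρ(sD_μ c) = −ρ(c(s_μ⁻¹−1))∘M_a∘ρ(s_μ) − M_{c(a−a(·−e_μ))}`),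
  ★★ `comp_firstOrder_eq_translate` (`G∘(M_c + Σ_μ M_{a_μ}∘ρ(sD_μ c)) = G∘(M_c − Σ_μ M_{c(a_μ − a_μ(·−e_μ))}) − Σ_μ (G∘ρ(c(s_μ⁻¹−1)))∘M_{a_μ}∘ρ(s_μ)` for ANY linear `G`),
  `mulOp_sub_sum_mulOp` (`M_c − Σ_μ M_{b_μ} = M_{c − Σ_μ b_μ}`).
* §2 `comp_fix_of_fix` (`X = G + K∘X ⟹ X∘E = G∘E + K∘(X∘E)`), ★★ `bgPairDiv_fix` (the dressed source divergence `pr₀(bgPair G (∇∘G) c a)∘E` solves `Y = G∘E + (G∘V₁)∘Y`, n15-b's pair with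
  II-B's `bgPair_value_fix'`).

HONEST FRAMING ∕ LIMITS.  Exact operator algebra and block-majorant bookkeeping on the `U ≡ 1` torus MODEL of [B5] §1; no analytic estimate; abelianised scalar-multiplier species (MODEL of
[B9] (3.52)'s `V′(A)`); nothing of [B5]∕[B6]∕[B9] asserted; NE2⁺ NOT PRINTED ∕ NOT proved; no statement of record touched; N15 NOT discharged; K3⁸ OPEN; counts UNMOVED (typed 28∕28 · discharged
5∕27); one finite torus (pair) — NOT infinite volume ∕ ℝ⁴ ∕ OS ∕ mass gap ∕ Clay.
-/

noncomputable section

open scoped BigOperators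
open Finset

namespace Summit.QuantumFields.YangMills.BalabanUVNodes.N15.TwoGrid

open Literature.MathematicalPhysics.QuantumFieldTheory.Balaban1983to89
open Literature.MathematicalPhysics.QuantumFieldTheory.Balaban1983to89.B6Prop26Gluing (mulOp mulOp_apply)
open Literature.MathematicalPhysics.QuantumFieldTheory.Balaban1983to89.B5Prop11Plancherel (Tor fine unitVec)
open Summit.QuantumFields.YangMills.BalabanUVNodes.N15.BackgroundLayer (bgPair projO stack unstack)

variable {d : ℕ}

/-! ## §1 The first-order step in translation form (one torus) -/

section Translate

variable (M : Fin (d + 1) → ℕ) [∀ μ, NeZero (M μ)] (n : ℕ) [NeZero n]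

omit [∀ μ, NeZero (M μ)] [NeZero n] in
/-- `τ_μ∘M_{a(·−e_μ)} = M_a∘τ_μ`: the forward unit shift moves a translated multiplier back (`a(x+e−e)·f(x+e) = a(x)·(τf)(x)`). [folklore] -/
theorem sT_comp_mulOp_translate (μ : Fin (d + 1)) (a : Tor (fine n M) × Fin (d + 1) → ℝ) :
    symbOp M n (sT M n μ) ∘ₗ mulOp (fun z => a (z.1 - unitVec (fine n M) μ, z.2)) = mulOp a ∘ₗ symbOp M n (sT M n μ) := by
  refine LinearMap.ext fun f => funext fun z => ?_
  simp only [LinearMap.comp_apply, mulOp_apply, symbOp_sT_apply, add_sub_cancel_right]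

omit [∀ μ, NeZero (M μ)] [NeZero n] in
/-- ★ **THE LATTICE LEIBNIZ RULE IN TRANSLATION FORM**: `M_a∘ρ(sD_μ c) = −ρ(c(s_μ⁻¹ − 1))∘M_a∘ρ(s_μ) − M_{c(a − a(·−e_μ))}` — the difference quotient is moved OFF the argument onto an
ADJOINT difference in front (whose composition with `G` is (1.110)'s «G∇*»), at the price of a forward unit shift of the argument and a multiplier by the coefficient's own backward quotient
(`a(x)c(f(x+e) − f(x)) = −c[(a·τf)(x−e) − (a·τf)(x)] − c(a(x) − a(x−e))f(x)`). [cite: Balaban1984PropagatorsI, (1.3) p.18, (1.31) p.23 (lattice difference quotients); Balaban1985BackgroundPropagators,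
(3.35) p.396 («|∇^ηA| < O(1)Mα₀(L^jη)^{−2}»: the letter paying the multiplier)] -/
theorem mulOp_comp_sD_eq_translate (μ : Fin (d + 1)) (cc : ℝ) (a : Tor (fine n M) × Fin (d + 1) → ℝ) :
    mulOp a ∘ₗ symbOp M n (sD M n μ cc) =
      -(symbOp M n (cc • (sTinv M n μ - 1)) ∘ₗ mulOp a ∘ₗ symbOp M n (sT M n μ)) - mulOp (fun z => cc * (a z - a (z.1 - unitVec (fine n M) μ, z.2))) := by
  refine LinearMap.ext fun f => funext fun z => ?_
  simp only [LinearMap.comp_apply, LinearMap.sub_apply, LinearMap.neg_apply, Pi.sub_apply, Pi.neg_apply, mulOp_apply, symbOp_sD_apply, symbOp_divAdj_apply,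
    symbOp_sT_apply, sub_add_cancel]
  ring

omit [∀ μ, NeZero (M μ)] [NeZero n] in
/-- ★★ **THE FIRST-ORDER STEP IN TRANSLATION FORM**, for ANY linear `G` on the fine 1-forms: `G∘(M_c + Σ_μ M_{a_μ}∘ρ(sD_μ c)) = G∘(M_c − Σ_μ M_{b_μ}) − Σ_μ (G∘ρ(c(s_μ⁻¹ − 1)))∘M_{a_μ}∘ρ(s_μ)`
with the BY-PARTS REMAINDERS `b_μ = c(a_μ − a_μ(·−e_μ))` — every operator factor is `G` or `G∘∇*_μ`; no derivative meets the argument. [cite: Balaban1985BackgroundPropagators, (3.52) p.400 (first-order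
species), (3.63) p.402 (the step `V′G′`: shapes); Balaban1984PropagatorsI, Prop. 1.2 (1.110) p.35 (the letters «G», «G∇*»)] -/
theorem comp_firstOrder_eq_translate {F₂ : Type} [AddCommGroup F₂] [Module ℝ F₂] (G : (Tor (fine n M) × Fin (d + 1) → ℝ) →ₗ[ℝ] F₂) (cc : ℝ)
    (c : Tor (fine n M) × Fin (d + 1) → ℝ) (a : Fin (d + 1) → Tor (fine n M) × Fin (d + 1) → ℝ) :
    G ∘ₗ (mulOp c + ∑ μ, mulOp (a μ) ∘ₗ symbOp M n (sD M n μ cc)) =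
      G ∘ₗ (mulOp c - ∑ μ, mulOp (fun z => cc * (a μ z - a μ (z.1 - unitVec (fine n M) μ, z.2)))) -
        ∑ μ, (G ∘ₗ symbOp M n (cc • (sTinv M n μ - 1))) ∘ₗ (mulOp (a μ) ∘ₗ symbOp M n (sT M n μ)) := by
  have hsum : (∑ μ, mulOp (a μ) ∘ₗ symbOp M n (sD M n μ cc)) =
      -(∑ μ, symbOp M n (cc • (sTinv M n μ - 1)) ∘ₗ (mulOp (a μ) ∘ₗ symbOp M n (sT M n μ))) -
        ∑ μ, mulOp (fun z => cc * (a μ z - a μ (z.1 - unitVec (fine n M) μ, z.2))) := by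
    rw [← Finset.sum_neg_distrib, ← Finset.sum_sub_distrib]
    refine Finset.sum_congr rfl fun μ _ => ?_
    rw [mulOp_comp_sD_eq_translate M n μ cc (a μ)]
  rw [hsum]
  simp only [LinearMap.comp_add, LinearMap.comp_sub, LinearMap.comp_neg]
  have hG : G ∘ₗ (∑ μ, symbOp M n (cc • (sTinv M n μ - 1)) ∘ₗ (mulOp (a μ) ∘ₗ symbOp M n (sT M n μ))) =
      ∑ μ, (G ∘ₗ symbOp M n (cc • (sTinv M n μ - 1))) ∘ₗ (mulOp (a μ) ∘ₗ symbOp M n (sT M n μ)) := by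
    refine LinearMap.ext fun f => ?_
    rw [LinearMap.comp_apply, LinearMap.sum_apply, LinearMap.sum_apply, map_sum]
    rfl
  rw [hG]
  abel

/-- The by-parts multiplier as ONE multiplication operator: `M_c − Σ_μ M_{b_μ} = M_{c − Σ_μ b_μ}`. [folklore] -/
theorem mulOp_sub_sum_mulOp {X ι : Type} [Fintype ι] (c : X → ℝ) (b : ι → X → ℝ) :
    (mulOp c - ∑ μ, mulOp (b μ) : (X → ℝ) →ₗ[ℝ] (X → ℝ)) = mulOp (fun z => c z - ∑ μ, b μ z) := by
  refine LinearMap.ext fun f => funext fun z => ?_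
  simp only [mulOp_apply, LinearMap.sub_apply, LinearMap.sum_apply, Pi.sub_apply, Finset.sum_apply, Finset.sum_mul, sub_mul]

end Translate

/-! ## §2 The fixed point of the dressed source divergence -/

section Fix

variable {X : Type} [Fintype X] [DecidableEq X]

omit [Fintype X] [DecidableEq X] in
/-- `X = G + K∘X ⟹ X∘E = G∘E + K∘(X∘E)`: a dressed object composed with ANY right factor solves the same fixed-point equation with the composed source. [folklore] -/
theorem comp_fix_of_fix {F₁ F₂ : Type} [AddCommGroup F₁] [Module ℝ F₁] [AddCommGroup F₂] [Module ℝ F₂] {Xv G : F₁ →ₗ[ℝ] (X → ℝ)} {K : (X → ℝ) →ₗ[ℝ] (X → ℝ)} (hfix : Xv = G + K ∘ₗ Xv)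
    (E : F₂ →ₗ[ℝ] F₁) : Xv ∘ₗ E = G ∘ₗ E + K ∘ₗ (Xv ∘ₗ E) := by
  conv_lhs => rw [hfix]
  rw [LinearMap.add_comp, LinearMap.comp_assoc]

variable {J : Type} [Fintype J] [DecidableEq J] {G : (X → ℝ) →ₗ[ℝ] (X → ℝ)} {Dc : J → (X → ℝ) →ₗ[ℝ] (X → ℝ)} {c : X → ℝ} {a : J → X → ℝ}

/-- ★★ **THE FIXED POINT OF THE DRESSED SOURCE DIVERGENCE.**  For n15-b's first-order dressed pair with derived pieces `∇_μ∘G` (value component `X = (1 − GV₁)⁻¹G`, `V₁ = M_c + Σ_μ M_{a_μ}∇_μ`)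
and ANY right factor `E` (the consumer's `E = ∇*_κ`): `Y := X∘E` solves `Y = G∘E + (G∘V₁)∘Y` — the source is the `U ≡ 1` entry `G∘E` («G∇*», (1.110)), the step is II-B's `G∘V₁`; combined with §1 the
step is in translation form. [cite: Balaban1985BackgroundPropagators, (3.62)–(3.65) pp.402–403 (resolvent identity, mechanism), Thm 3.1 (3.42) p.397 (the entry `G(U)∇*`: shape)] -/
theorem bgPairDiv_fix (hunit : IsUnit (1 - LinearMap.toMatrix' (stack G (fun μ => Dc μ ∘ₗ G) ∘ₗ unstack c a))) {F₂ : Type} [AddCommGroup F₂] [Module ℝ F₂] (E : F₂ →ₗ[ℝ] (X → ℝ)) :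
    (projO none ∘ₗ bgPair G (fun μ => Dc μ ∘ₗ G) c a) ∘ₗ E =
      G ∘ₗ E + (G ∘ₗ (mulOp c + ∑ μ, mulOp (a μ) ∘ₗ Dc μ)) ∘ₗ ((projO none ∘ₗ bgPair G (fun μ => Dc μ ∘ₗ G) c a) ∘ₗ E) := by
  have hfix : projO none ∘ₗ bgPair G (fun μ => Dc μ ∘ₗ G) c a = G + (G ∘ₗ (mulOp c + ∑ μ, mulOp (a μ) ∘ₗ Dc μ)) ∘ₗ (projO none ∘ₗ bgPair G (fun μ => Dc μ ∘ₗ G) c a) := by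
    rw [LinearMap.comp_assoc]
    exact bgPair_value_fix' (G := G) (Dc := Dc) (c := c) (a := a) hunit
  exact comp_fix_of_fix hfix E

end Fix

end Summit.QuantumFields.YangMills.BalabanUVNodes.N15.TwoGrid

end
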